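import Summits.CriticalPhenomena.PercolationContinuityZ3.Theorems.PercNearOneGluingNoHeavyLowerTailSunflowerAntipodalMatching
import Summits.CriticalPhenomena.PercolationContinuityZ3.Theorems.PercNearOneGluingNoHeavyLowerTailSahiChainLemma
import Mathlib.Data.ZMod.Basic
import Mathlib.Data.Finset.Interval
import HarnessLib
import HarnessLib.Audit

/-!
# `NoHeavyLowerTail` (crux stmt-CriticalPhenomena-4575), abstract sunflower cubic: the GF(2) PARITY LEMMA `Ξ² = I` of a single up-set

Support file (seat `prim-l12-p2` gen 17; `--supports stmt-CriticalPhenomena-4575`).  No `sorry`, no new definitions.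
Memo: run/shared/lean/prim/prim-l12/prim-l12-p2/FINDING-g17-HALL-GLADKOV-PROVED.md.

This is the engine of the GF(2)-rank proof of the HALL–GLADKOV matching conjecture (`HallGladkov`, `IXGen` of
`…SunflowerHallGladkov`; the proof itself is in the companion files `…SunflowerHallGladkovKernel` / `…SunflowerHallGladkovProof`).
For an up-set `G` of the cube `W` put `IN(G) = {S ⊆ W : S ∈ G, W∖S ∉ G}` (`inV G W`) and `OUT(G) = {T ⊆ W : T ∉ G, W∖T ∈ G}` (`outV G W`),
and for `T, T″ ∈ OUT(G)`, `S ⊆ W`: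
  `γ(T,S) = #{R : T ⊆ R ⊆ S, W∖R ∈ G}`,   `δ(S,T″) = #{C ∈ G : T″ ⊆ C ⊆ S}`.
**Parity lemma** (`gam_del_sum`): `Σ_{S ∈ IN(G)} γ(T,S)·δ(S,T″) ≡ [T = T″] (mod 2)`.  Equivalently the square matrix
`[#([O,L] ∩ G) mod 2]_{L ∈ IN(G), O ∈ OUT(G)}` is an involution up to the complement re-indexing, hence NONSINGULAR over `GF(2)` for every up-set —
a rank refinement of Gladkov's two-family inequality.  Proof: the summand vanishes off `IN(G)`, so the sum runs over the whole cube; exchanging the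
order of summation, every inner sum is the number of supersets of a fixed set, which is odd iff that set is `W`.
Also recorded: the parity toolkit (`#{u ⊆ B : A ⊆ u} ≡ [A = B]`; `2^n mod 2` is `SahiSharedCube.natCast_two_pow_zmod_two`), used throughout the companion files.
-/

namespace Summit.CriticalPhenomena.PercolationContinuityZ3.Theorems.SunflowerPartition

open Finset

namespace HallGladkov

variable {α : Type*} [DecidableEq α]

/-! ## Parity toolkit -/

omit [DecidableEq α] in
/-- Up-set membership transport (coercion-free form). [folklore] -/
theorem up_mem {G : Finset (Finset α)} (hG : IsUpperSet (G : Set (Finset α))) {A B : Finset α} (hAB : A ⊆ B) (hA : A ∈ G) :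
    B ∈ G := hG hAB hA

omit [DecidableEq α] in
/-- Up-set non-membership transport downwards. [folklore] -/
theorem up_not_mem {G : Finset (Finset α)} (hG : IsUpperSet (G : Set (Finset α))) {A B : Finset α} (hAB : A ⊆ B) (hB : B ∉ G) :
    A ∉ G := fun hA => hB (hG hAB hA)

/-- **Parity of an interval**: `#{u ⊆ B : A ⊆ u} ≡ [A = B] (mod 2)`. [folklore] -/
theorem sum_powerset_ite_superset (A B : Finset α) :
    (∑ u ∈ B.powerset, (if A ⊆ u then (1 : ZMod 2) else 0)) = if A = B then 1 else 0 := by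
  rw [Finset.sum_boole]
  by_cases hAB : A ⊆ B
  · rw [← Finset.Icc_eq_filter_powerset, Finset.card_Icc_finset hAB, SahiSharedCube.natCast_two_pow_zmod_two]
    by_cases h : A = B
    · subst h; simp
    · rw [if_neg h, if_neg]
      intro hk
      exact h (Finset.eq_of_subset_of_card_le hAB (Nat.sub_eq_zero_iff_le.1 hk))
  · have hne : A ≠ B := fun h => hAB (h ▸ subset_rfl)
    rw [if_neg hne, Finset.filter_eq_empty_iff.2 (fun u hu hAu => hAB (hAu.trans (mem_powerset.1 hu)))]
    simp

/-- Interval parity inside a bigger cube: for `B ⊆ W`, `#{R ⊆ W : A ⊆ R ⊆ B} ≡ [A = B] (mod 2)`. [folklore] -/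
theorem sum_powerset_ite_Icc {A B W : Finset α} (hB : B ⊆ W) :
    (∑ R ∈ W.powerset, (if A ⊆ R ∧ R ⊆ B then (1 : ZMod 2) else 0)) = if A = B then 1 else 0 := by
  have hf : W.powerset.filter (fun R => A ⊆ R ∧ R ⊆ B) = B.powerset.filter (fun R => A ⊆ R) := by
    ext R
    simp only [mem_filter, mem_powerset]
    constructor
    · rintro ⟨-, hAR, hRB⟩; exact ⟨hRB, hAR⟩
    · rintro ⟨hRB, hAR⟩; exact ⟨hRB.trans hB, hAR, hRB⟩
  rw [← sum_powerset_ite_superset A B, Finset.sum_boole, Finset.sum_boole, hf]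

/-- Swapping `S ↔ W ∖ S` in a sum over a cube (any additive commutative monoid). [folklore] -/
theorem sum_powerset_compl {M : Type*} [AddCommMonoid M] (W : Finset α) (f : Finset α → M) :
    ∑ S ∈ W.powerset, f (W \ S) = ∑ S ∈ W.powerset, f S := by
  refine sum_bij' (fun S _ => W \ S) (fun S _ => W \ S) ?_ ?_ ?_ ?_ ?_
  · intro S _; exact mem_powerset.2 sdiff_subset
  · intro S _; exact mem_powerset.2 sdiff_subset
  · intro S hS; exact Finset.sdiff_sdiff_eq_self (mem_powerset.1 hS)
  · intro S hS; exact Finset.sdiff_sdiff_eq_self (mem_powerset.1 hS)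
  · intro S _; rfl

/-- `R ∪ C = W ↔ W ∖ R ⊆ C` for `R, C ⊆ W`. [folklore] -/
theorem union_eq_iff_sdiff_subset {R C W : Finset α} (hR : R ⊆ W) (hC : C ⊆ W) : R ∪ C = W ↔ W \ R ⊆ C := by
  constructor
  · intro h x hx
    rw [mem_sdiff] at hx
    have hxW : x ∈ R ∪ C := h ▸ hx.1
    rcases mem_union.1 hxW with hxR | hxC
    · exact absurd hxR hx.2
    · exact hxC
  · intro h
    refine Subset.antisymm (union_subset hR hC) fun x hx => ?_
    by_cases hxR : x ∈ R
    · exact mem_union.2 (Or.inl hxR)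
    · exact mem_union.2 (Or.inr (h (mem_sdiff.2 ⟨hx, hxR⟩)))

/-- `T ∪ (W ∖ R) = W ↔ R ⊆ T` for `R, T ⊆ W`. [folklore] -/
theorem union_sdiff_eq_iff_subset {R T W : Finset α} (hR : R ⊆ W) (hT : T ⊆ W) : T ∪ (W \ R) = W ↔ R ⊆ T := by
  rw [union_eq_iff_sdiff_subset hT sdiff_subset]
  constructor
  · intro h x hxR
    by_contra hxT
    have : x ∈ W \ R := h (mem_sdiff.2 ⟨hR hxR, hxT⟩)
    exact (mem_sdiff.1 this).2 hxR
  · intro h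
    exact Finset.sdiff_subset_sdiff subset_rfl h

/-! ## The parity lemma `Ξ² = I` -/

/-- Off `IN(G)`, inside `G ∩ τG`: `γ(T,S) ≡ 0` for `T ∉ G`, `S ∈ G`, `W∖S ∈ G`. [this work] -/
theorem gam_eq_zero_of_mem_mem {G : Finset (Finset α)} (hG : IsUpperSet (G : Set (Finset α))) {W T S : Finset α}
    (hTG : T ∉ G) (hSW : S ⊆ W) (hSG : S ∈ G) (hScG : W \ S ∈ G) :
    (∑ R ∈ W.powerset, (if T ⊆ R ∧ R ⊆ S ∧ W \ R ∈ G then (1 : ZMod 2) else 0)) = 0 := by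
  have hTS : T ≠ S := fun h => hTG (h ▸ hSG)
  calc (∑ R ∈ W.powerset, (if T ⊆ R ∧ R ⊆ S ∧ W \ R ∈ G then (1 : ZMod 2) else 0))
      = ∑ R ∈ W.powerset, (if T ⊆ R ∧ R ⊆ S then (1 : ZMod 2) else 0) := by
        refine sum_congr rfl fun R _ => ?_
        by_cases h : T ⊆ R ∧ R ⊆ S
        · rw [if_pos h, if_pos ⟨h.1, h.2, up_mem hG (Finset.sdiff_subset_sdiff subset_rfl h.2) hScG⟩]
        · rw [if_neg h, if_neg fun h' => h ⟨h'.1, h'.2.1⟩]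
    _ = if T = S then 1 else 0 := sum_powerset_ite_Icc hSW
    _ = 0 := if_neg hTS

/-- Off `IN(G)`, outside `G`: `δ(S,T″) = 0` for `S ∉ G`. [this work] -/
theorem del_eq_zero_of_not_mem {G : Finset (Finset α)} (hG : IsUpperSet (G : Set (Finset α))) {W T'' S : Finset α}
    (hSG : S ∉ G) :
    (∑ C ∈ W.powerset, (if C ∈ G ∧ T'' ⊆ C ∧ C ⊆ S then (1 : ZMod 2) else 0)) = 0 := by
  refine sum_eq_zero fun C _ => ?_
  rw [if_neg]
  rintro ⟨hCG, -, hCS⟩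
  exact hSG (up_mem hG hCS hCG)

/-- **PARITY LEMMA `Ξ² = I`** (this work).  For an up-set `G` of the cube `W` and `T, T″ ∈ OUT(G)`:
`Σ_{S ∈ IN(G)} γ(T,S)·δ(S,T″) ≡ [T = T″] (mod 2)`, where `γ(T,S) = #{R : T ⊆ R ⊆ S, W∖R ∈ G}` and
`δ(S,T″) = #{C ∈ G : T″ ⊆ C ⊆ S}`.  Hence the `GF(2)` matrix `[#([O,L]∩G)]_{L ∈ IN(G), O ∈ OUT(G)}` is nonsingular. [this work] -/
theorem gam_del_sum {G : Finset (Finset α)} (hG : IsUpperSet (G : Set (Finset α))) (W : Finset α)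
    {T T'' : Finset α} (hT : T ∈ outV G W) (hT'' : T'' ∈ outV G W) :
    (∑ S ∈ inV G W,
        (∑ R ∈ W.powerset, (if T ⊆ R ∧ R ⊆ S ∧ W \ R ∈ G then (1 : ZMod 2) else 0)) *
        (∑ C ∈ W.powerset, (if C ∈ G ∧ T'' ⊆ C ∧ C ⊆ S then (1 : ZMod 2) else 0)))
      = if T = T'' then 1 else 0 := by
  unfold outV at hT hT''
  rw [mem_filter, mem_powerset] at hT hT''
  obtain ⟨-, hTG, -⟩ := hT
  obtain ⟨hT2W, -, hT2cG⟩ := hT''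
  -- (a) the summand vanishes off `IN(G)`: sum over the whole cube
  have hsub : inV G W ⊆ W.powerset := fun S hS => by unfold inV at hS; exact (mem_filter.1 hS).1
  rw [Finset.sum_subset hsub ?vanish]
  case vanish =>
    intro S hS hSn
    have hSW : S ⊆ W := mem_powerset.1 hS
    have hSn' : ¬ (S ∈ G ∧ W \ S ∉ G) := fun h => hSn (by unfold inV; exact mem_filter.2 ⟨hS, h⟩)
    by_cases hSG : S ∈ G
    · have hScG : W \ S ∈ G := by by_contra h; exact hSn' ⟨hSG, h⟩
      rw [gam_eq_zero_of_mem_mem hG hTG hSW hSG hScG, zero_mul]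
    · rw [del_eq_zero_of_not_mem hG hSG, mul_zero]
  -- (b) expand the product and exchange the order of summation; the `S`-sum counts supersets of `R ∪ C`
  have hb : ∀ R ∈ W.powerset, ∀ C ∈ W.powerset,
      (∑ S ∈ W.powerset, ((if T ⊆ R ∧ R ⊆ S ∧ W \ R ∈ G then (1 : ZMod 2) else 0) *
         (if C ∈ G ∧ T'' ⊆ C ∧ C ⊆ S then (1 : ZMod 2) else 0)))
        = (if T ⊆ R ∧ W \ R ∈ G ∧ C ∈ G ∧ T'' ⊆ C then (1 : ZMod 2) else 0) * (if R ∪ C = W then 1 else 0) := by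
    intro R _ C _
    rw [← sum_powerset_ite_superset (R ∪ C) W, Finset.mul_sum]
    refine sum_congr rfl fun S _ => ?_
    simp only [ite_zero_mul_ite_zero, one_mul]
    by_cases h1 : T ⊆ R ∧ W \ R ∈ G ∧ C ∈ G ∧ T'' ⊆ C
    · by_cases h2 : R ∪ C ⊆ S
      · rw [if_pos ⟨⟨h1.1, subset_union_left.trans h2, h1.2.1⟩, h1.2.2.1, h1.2.2.2, subset_union_right.trans h2⟩,
          if_pos ⟨h1, h2⟩]
      · rw [if_neg, if_neg fun h => h2 h.2]
        rintro ⟨⟨-, hRS, -⟩, -, -, hCS⟩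
        exact h2 (union_subset hRS hCS)
    · rw [if_neg, if_neg fun h => h1 h.1]
      rintro ⟨⟨hTR, -, hRG⟩, hCG, hTC, -⟩
      exact h1 ⟨hTR, hRG, hCG, hTC⟩
  rw [show (∑ S ∈ W.powerset,
        (∑ R ∈ W.powerset, (if T ⊆ R ∧ R ⊆ S ∧ W \ R ∈ G then (1 : ZMod 2) else 0)) *
        (∑ C ∈ W.powerset, (if C ∈ G ∧ T'' ⊆ C ∧ C ⊆ S then (1 : ZMod 2) else 0)))
      = ∑ R ∈ W.powerset, ∑ C ∈ W.powerset,
          ((if T ⊆ R ∧ W \ R ∈ G ∧ C ∈ G ∧ T'' ⊆ C then (1 : ZMod 2) else 0) * (if R ∪ C = W then 1 else 0)) by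
    rw [show (∑ S ∈ W.powerset,
        (∑ R ∈ W.powerset, (if T ⊆ R ∧ R ⊆ S ∧ W \ R ∈ G then (1 : ZMod 2) else 0)) *
        (∑ C ∈ W.powerset, (if C ∈ G ∧ T'' ⊆ C ∧ C ⊆ S then (1 : ZMod 2) else 0)))
      = ∑ S ∈ W.powerset, ∑ R ∈ W.powerset, ∑ C ∈ W.powerset,
          ((if T ⊆ R ∧ R ⊆ S ∧ W \ R ∈ G then (1 : ZMod 2) else 0) *
           (if C ∈ G ∧ T'' ⊆ C ∧ C ⊆ S then (1 : ZMod 2) else 0)) from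
      sum_congr rfl fun S _ => Finset.sum_mul_sum _ _ _ _]
    rw [Finset.sum_comm]
    refine sum_congr rfl fun R hR => ?_
    rw [Finset.sum_comm]
    exact sum_congr rfl fun C hC => hb R hR C hC]
  -- (c) the `C`-sum: for `W ∖ R ∈ G` it counts the supersets of `T″ ∪ (W ∖ R)`, odd iff `R ⊆ T″`
  have hc : ∀ R ∈ W.powerset,
      (∑ C ∈ W.powerset, ((if T ⊆ R ∧ W \ R ∈ G ∧ C ∈ G ∧ T'' ⊆ C then (1 : ZMod 2) else 0) *
          (if R ∪ C = W then 1 else 0)))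
        = if T ⊆ R ∧ R ⊆ T'' then 1 else 0 := by
    intro R hR
    have hRW : R ⊆ W := mem_powerset.1 hR
    by_cases h1 : T ⊆ R ∧ W \ R ∈ G
    · rw [show (if T ⊆ R ∧ R ⊆ T'' then (1 : ZMod 2) else 0) = if T'' ∪ (W \ R) = W then 1 else 0 by
        by_cases h : R ⊆ T''
        · rw [if_pos ⟨h1.1, h⟩, if_pos ((union_sdiff_eq_iff_subset hRW hT2W).2 h)]
        · rw [if_neg fun h' => h h'.2, if_neg fun h' => h ((union_sdiff_eq_iff_subset hRW hT2W).1 h')]]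
      rw [← sum_powerset_ite_superset (T'' ∪ (W \ R)) W]
      refine sum_congr rfl fun C hC => ?_
      have hCW : C ⊆ W := mem_powerset.1 hC
      simp only [ite_zero_mul_ite_zero, one_mul]
      by_cases h : T'' ∪ (W \ R) ⊆ C
      · have hRC : W \ R ⊆ C := subset_union_right.trans h
        rw [if_pos h, if_pos ⟨⟨h1.1, h1.2, up_mem hG hRC h1.2, subset_union_left.trans h⟩,
          (union_eq_iff_sdiff_subset hRW hCW).2 hRC⟩]
      · rw [if_neg h, if_neg]
        rintro ⟨⟨-, -, -, hTC⟩, hRCW⟩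
        exact h (union_subset hTC ((union_eq_iff_sdiff_subset hRW hCW).1 hRCW))
    · rw [if_neg fun h => h1 ⟨h.1, up_mem hG (Finset.sdiff_subset_sdiff subset_rfl h.2) hT2cG⟩]
      refine sum_eq_zero fun C _ => ?_
      rw [if_neg fun h => h1 ⟨h.1, h.2.1⟩, zero_mul]
  rw [sum_congr rfl hc]
  -- (d) the `R`-sum is an interval count
  exact sum_powerset_ite_Icc hT2W

end HallGladkov

end Summit.CriticalPhenomena.PercolationContinuityZ3.Theorems.SunflowerPartition
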